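import Summits.HodgeConjecture.HodgeConjecture.Theorems.MarkmanPartnerTransportPicardThreeK3SquaresIsogenyInvariance

/-!
# Route MarkmanPartnerTransport · crux `PicardThreeK3Squares` (stmt-HodgeConjecture-19652) —
# EVERY rational isometry of `Λ_ℚ` is realised by an isogenous marked projective K3 surface
# (modulo the surjectivity of the period map)

Companion of `…IsogenyInvariance`. There the Hodge conjecture for `S ⊗ S` was shown to depend only on
the rational Hodge-isometry class of the marked lattice `(H²(S, ℚ), ∪, H^{2,0})` — HC⁴ transports along
a rational isometry `σ` of `(Λ_ℂ, k3Form)` carrying the period of one marked projective K3 surface into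
the period line of another (mod `Buskin2019_hodgeIsometry_algebraic`). Here we record the EXISTENCE half
of the reduction «reduce Picard-rank-3 squares to isometry classes»: for every marked projective K3
surface `(S, η, p, x)` and EVERY isometry `σ` of `(Λ_ℂ, k3Form)` defined over `ℚ`, the vector `σ x` is
again a projective period point (`periodPt_ratIsometry`: `σ` is a product of reflections along lattice
vectors, `exists_eq_prod_k3ReflectionC`, and `k3PeriodHypotheses_prod_k3ReflectionC`), hence — GRANTED the
surjectivity of the period map in its projective form (the tree's named fact
`Huybrechts_K3_periodSurjective_projective`, Huybrechts Ch. 6–7) — there is a marked projective K3 surface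
`(S', η', p', σ x)` (`exists_markedK3_ratIsometry`), which is isogenous to `S` along `σ⁻¹`; so
`HodgeConjectureFor 4 (S ⊗ S) ↔ HodgeConjectureFor 4 (S' ⊗ S')` (`exists_isogenous_markedK3`, mod Buskin).
In words: the isogeny class of a projective K3 surface visits EVERY period `σ x`, `σ ∈ O(Λ_ℚ)` — the
freedom used downstream to move `T(S)_ℚ` inside `Λ_ℚ` (e.g. into the invariant lattice of the Nikulin
involution, by the codimension-`3` representation theorem) without changing the truth value of HC⁴(S ⊗ S).

* `periodPt_ratIsometry` — rational isometries of `Λ_ℂ` preserve projective period points.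
* `exists_markedK3_ratIsometry` — a marked projective K3 surface with period `σ x` (mod period surjectivity),
  with the full marking clause of the crux (`p' ≠ 0` by `generator_ne_zero`).
* `exists_isogenous_markedK3` — the same together with the HC⁴-equivalence (mod Buskin).

No definition, no sorry; named-fact hypotheses `Huybrechts_K3_periodSurjective_projective` and (for the last
statement) `Buskin2019_hodgeIsometry_algebraic`. Prover seat hodge-nonav-19652-p1 (gen 3),
`--supports stmt-HodgeConjecture-19652`.

References: Buskin, J. reine angew. Math. 755 (2019), §6.2 (proof of Thm. 1.1: the chain of marked K3
surfaces along a rational isometry); Huybrechts, Comment. Math. Helv. 94 (2019), §1.1; Huybrechts,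
*Lectures on K3 Surfaces*, Ch. 6 Rem. 3.3, Ch. 7 Thm. 4.1 (surjectivity of the period map).
-/

set_option linter.dupNamespace false

noncomputable section

namespace Summit.HodgeConjecture.HodgeConjecture.Theorems.MarkmanPartnerTransport.IsogenyInvariance

open CategoryTheory MonoidalCategory
open Literature.AlgebraicGeometry Literature.AlgebraicGeometry.Motives Literature.AlgebraicGeometry.HodgeTheory
open Literature.AlgebraicGeometry.Surfaces
open Literature.AlgebraicTopology.SingularHomology
open Summit.HodgeConjecture.HodgeConjecture.Theorems.NikulinTwinTransport

variable {S : SchemeOver ℂ}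

/-- `MarkedK3[S, η, p, x]`: VERBATIM the `let MarkedK3 := …` binder of the route declaration
`PicardThreeK3Squares`. Local notation only. -/
local notation3 (prettyPrint := false) "MarkedK3[" S ", " η ", " p ", " x "]" =>
  (p ≠ 0 ∧ (IsIntegralClass p ∧
    (∀ q : complexBetti S (2 * 2), IsIntegralClass q → ∃ n : ℤ, q = n • p) ∧
    (∀ c : complexBetti S (2 * 1), IsIntegralClass c ↔ ∃ v : K3Index → ℤ, η c = fun i => (v i : ℂ)) ∧
    (∀ a b : complexBetti S (2 * 1),
      cupProduct (rfl : 2 * 1 + 2 * 1 = 2 * 2) a b = k3Form (η a) (η b) • p) ∧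
    IsOfHodgeType 2 S (2 * 1) 2 0 (LinearEquiv.symm η x) ∧
    (∀ τ : complexBetti S (2 * 1), IsOfHodgeType 2 S (2 * 1) 2 0 τ →
      ∃ t : ℂ, τ = t • LinearEquiv.symm η x)) ∧
    (k3Form x x = 0 ∧ 0 < (k3Form (star x) x).re ∧
      ∃ u : K3Index → ℤ, k3Form (fun i => (u i : ℂ)) x = 0 ∧ 0 < ∑ i, ∑ j, u i * k3Gram i j * u j))

/-- `PeriodPt[x]`: `x ∈ Λ_ℂ` satisfies the hypotheses of `Huybrechts_K3_periodSurjective_projective`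
(`(x.x) = 0`, `(x̄.x) > 0`, a positive lattice vector in `x^⊥`). Local notation only. -/
local notation3 (prettyPrint := false) "PeriodPt[" x "]" =>
  (k3Form x x = 0 ∧ 0 < (k3Form (star x) x).re ∧
    ∃ u : K3Index → ℤ, k3Form (fun i => (u i : ℂ)) x = 0 ∧ 0 < ∑ i, ∑ j, u i * k3Gram i j * u j)

/-! ### Rational isometries preserve projective period points -/

/-- **A rational isometry of `(Λ_ℂ, k3Form)` carries projective period points to projective period
points.** `σ` is a product `s_{v₁} ∘ ⋯ ∘ s_{v_m}` of reflections along non-isotropic lattice vectors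
(Cartan–Dieudonné over `ℚ`, `exists_eq_prod_k3ReflectionC`), and each reflection preserves the three
clauses (`k3PeriodHypotheses_prod_k3ReflectionC`: `(x.x) = 0`, `(x̄.x) > 0` by reality, and a positive
lattice vector orthogonal to `x` goes to a positive rational vector orthogonal to the image, a multiple of
which is integral). [cite: Buskin2019, §6.2 (proof of Thm. 1.1)] [cite: Huybrechts2016K3, Ch. 6 Rem. 3.3] -/
theorem periodPt_ratIsometry (σ : Module.End ℂ (K3Index → ℂ))
    (hσ : ∀ a b, k3Form (σ a) (σ b) = k3Form a b)
    (hrat : ∀ v : K3Index → ℤ, ∃ w : K3Index → ℚ, σ (fun i => (v i : ℂ)) = fun i => (w i : ℂ))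
    {x : K3Index → ℂ} (hx : PeriodPt[x]) : PeriodPt[σ x] := by
  obtain ⟨l, -, -, rfl⟩ := exists_eq_prod_k3ReflectionC σ hσ hrat
  exact k3PeriodHypotheses_prod_k3ReflectionC l hx.1 hx.2.1 hx.2.2

/-! ### A marked projective K3 surface at the period `σ x` -/

/-- **Every rational isometry of `Λ_ℚ` is realised by a marked projective K3 surface** (mod the
surjectivity of the period map): for a projective period point `x` and an isometry `σ` of
`(Λ_ℂ, k3Form)` defined over `ℚ`, there is a projective K3 surface `S'` with a marking `(η', p', σ x)`
satisfying VERBATIM the marking clause of the crux `PicardThreeK3Squares` (`p' ≠ 0` by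
`generator_ne_zero`; the `(2,0)`-line is `ℂ η'⁻¹(σ x)`). This is the first paragraph of Buskin's
proof of Thm. 1.1 / Huybrechts 2019 §1.1 ("we obtain a sequence of marked K3 surfaces …"), for the
whole isometry at once. [cite: Buskin2019, §6.2 (proof of Thm. 1.1)] [cite: Huybrechts2016K3, Ch. 7 Thm. 4.1 and Ch. 6 Rem. 3.3] -/
theorem exists_markedK3_ratIsometry (hPS : Huybrechts_K3_periodSurjective_projective)
    (σ : Module.End ℂ (K3Index → ℂ)) (hσ : ∀ a b, k3Form (σ a) (σ b) = k3Form a b)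
    (hrat : ∀ v : K3Index → ℤ, ∃ w : K3Index → ℚ, σ (fun i => (v i : ℂ)) = fun i => (w i : ℂ))
    {x : K3Index → ℂ} (hx : PeriodPt[x]) :
    ∃ (S' : SchemeOver ℂ) (_ : IsK3Surface S') (η' : complexBetti S' (2 * 1) ≃ₗ[ℂ] (K3Index → ℂ))
      (p' : complexBetti S' (2 * 2)), MarkedK3[S', η', p', σ x] := by
  have hx' := periodPt_ratIsometry σ hσ hrat hx
  obtain ⟨S', hS', η', p', hint, hgen, hη'int, hη'cup, h20', hspan'⟩ := hPS (σ x) hx'.1 hx'.2.1 hx'.2.2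
  exact ⟨S', hS', η', p', generator_ne_zero hS' hgen, ⟨hint, hgen, hη'int, hη'cup, h20', hspan'⟩, hx'⟩

/-- **The isogeny class of a marked projective K3 surface visits every period `σ x`, `σ ∈ O(Λ_ℚ)`,
with the same truth value of HC⁴ of the square** (mod Buskin and the surjectivity of the period map):
for `(S, η, p, x)` marked projective and `σ` a rational isometry of `(Λ_ℂ, k3Form)` there is a marked
projective K3 surface `(S', η', p', σ x)` with
`HodgeConjectureFor 4 (S ⊗ S) ↔ HodgeConjectureFor 4 (S' ⊗ S')` (the isogeny runs along `σ⁻¹`,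
`exists_inverse_ratIsometry`, through `hodgeConjectureFor_square_iff_of_markedIsometry`).
[cite: Buskin2019, Thm. 1.1 and §6.2] [cite: Huybrechts2019, §1.1] -/
theorem exists_isogenous_markedK3 (hB : Buskin2019_hodgeIsometry_algebraic)
    (hPS : Huybrechts_K3_periodSurjective_projective) (hS : IsK3Surface S)
    (η : complexBetti S (2 * 1) ≃ₗ[ℂ] (K3Index → ℂ)) (p : complexBetti S (2 * 2)) (x : K3Index → ℂ)
    (hM : MarkedK3[S, η, p, x])
    (σ : Module.End ℂ (K3Index → ℂ)) (hσ : ∀ a b, k3Form (σ a) (σ b) = k3Form a b)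
    (hrat : ∀ v : K3Index → ℤ, ∃ w : K3Index → ℚ, σ (fun i => (v i : ℂ)) = fun i => (w i : ℂ)) :
    ∃ (S' : SchemeOver ℂ) (_ : IsK3Surface S') (η' : complexBetti S' (2 * 1) ≃ₗ[ℂ] (K3Index → ℂ))
      (p' : complexBetti S' (2 * 2)), MarkedK3[S', η', p', σ x] ∧
      (HodgeConjectureFor 4 (S ⊗ S) ↔ HodgeConjectureFor 4 (S' ⊗ S')) := by
  obtain ⟨S', hS', η', p', hM'⟩ := exists_markedK3_ratIsometry hPS σ hσ hrat hM.2.2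
  refine ⟨S', hS', η', p', hM', ?_⟩
  -- the isogeny `σ⁻¹` carries the period `σ x` of `S'` to `x`
  obtain ⟨σ', -, hσ'σ, hσ', hσ'rat⟩ := exists_inverse_ratIsometry σ hσ hrat
  obtain ⟨-, ⟨hpint, hpgen, hηint, hηcup, h20, -⟩, -, hxpos, -⟩ := hM
  obtain ⟨-, ⟨hp'int, hp'gen, hη'int, hη'cup, h20', -⟩, -, hx'pos, -⟩ := hM'
  exact hodgeConjectureFor_square_iff_of_markedIsometry hB hS hS' η p x η' p' (σ x) ⟨hpint, hpgen⟩
    hηint hηcup h20 hxpos ⟨hp'int, hp'gen⟩ hη'int hη'cup h20' hx'pos σ' hσ' hσ'rat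
    ⟨1, by rw [hσ'σ, one_smul]⟩

end Summit.HodgeConjecture.HodgeConjecture.Theorems.MarkmanPartnerTransport.IsogenyInvariance

end
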